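import Mathlib
import Summits.NavierStokesRegularity.NavierStokesRegularity.Theorems.ThreadingFluxSilentShellsJiuXinTools
import HarnessLib

/-!
# Crux `PoloidalLiouville` (stmt-NavierStokesRegularity-1222, W1), crux idea «silent-shells»:
# Jiu–Xin compact Liouville — axis Bernoulli, the radial cut-off, and the two `ε → 0` limits

Second of three files proving (O1) `jiuXin_noSwirl_liouville` UNCONDITIONALLY (sketch
`Cruxes/PoloidalLiouville/SilentShellsSketch.lean` v1.4 l.268).  With the generalised virial identity of
`ThreadingFluxSilentShellsJiuXinTools` at the Jiu–Xin field `G_ε = x_h/(ρ²+ε²)` one has, for a compactly supported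
`C¹` steady axisymmetric no-swirl Euler pair `(U, P)` with `P ≡ p₀` off `B̄(0,R)`,
`∫ |U_h|² (ρ² − ε²)/(ρ²+ε²)² = ∫ (P − p₀) · 2ε²/(ρ²+ε²)²` (Jiu–Xin (3.24) regularised).  This file supplies:

* `JiuXin.axis_bernoulli` — on the axis `P − p₀ = −½ U₂²` (the axis is a streamline from rest at infinity), hence
  `P − p₀ ≤ 0` there [JiuXin2008, (3.27)–(3.28)], and the near-axis bound `P(x) − p₀ ≤ M_P ρ(x)`;
* `JiuXin.cutoff R` — a smooth radial cut-off `χ = 1` on `B̄(0,R)`, `= 0` off `B̄(0,2R)`, with `Dχ(x) v = c(x) ⟪x, v⟫`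
  and `c` continuous of compact support, so that `∫ χ · div G_ε = −∫ ⟪G_ε, ∇χ⟫ ≤ ∫ |c|` UNIFORMLY in `ε`
  (the mass `2π` per unit length of the approximate identity `div G_ε`, controlled without cylindrical coordinates);
* `JiuXin.tendsto_integral_horSq` — `∫ |U_h|²(ρ²−ε²)/(ρ²+ε²)² → ∫ |U_h|²/ρ²` (dominated by `‖DU‖²_∞` on the support,
  from the axis bound `|U_h|² ≤ M²ρ²`);
* `JiuXin.tendsto_integral_cutoff_cylSq_div` — `∫ χ ρ² div G_ε → 0`.

All `--supports stmt-NavierStokesRegularity-1222 --as helper`; W1 movement 0; NS regularity is NOT proved by any of this.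
Reference: Q. Jiu, Z. Xin, Comm. Math. Phys. 287 (2009) 323–350, Thm 5.3, (3.22)–(3.28).
-/

-- the summit and its single problem share the name (D-0017 nested layout)
set_option linter.dupNamespace false

noncomputable section

namespace Summit.NavierStokesRegularity.NavierStokesRegularity.Theorems.PoloidalLiouville.SilentShells

open Set Function Filter MeasureTheory Topology Metric
open scoped Topology RealInnerProductSpace
open Literature.Analysis.FluidPDE
open Summit.NavierStokesRegularity.NavierStokesRegularity.Theorems.PoloidalLiouville.HorizonTower (E3)

namespace JiuXin

/-! ## The axis: Bernoulli from rest at infinity -/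

/-- The axis point below `x`: `x − x_h = x₂ e₂`. -/
theorem sub_hor_eq_smul (x : E3) : x - hor x = (x 2) • EuclideanSpace.single 2 (1 : ℝ) := by
  ext i
  fin_cases i <;> simp

section Euler

variable {U : E3 → E3} {P : E3 → ℝ}

/-- **Bernoulli on the axis.** For a `C¹` steady Euler pair with axisymmetric `U`, compactly supported in `B̄(0,R)`,
and `P ≡ p₀` off `B̄(0,R)`: `P(t e₂) − p₀ = −½ U₂(t e₂)²` for every `t` — on the axis `U = U₂ e₂`, so
`∂ₜ(½U₂² + P)(t e₂) = U₂ ∂₂U₂ + ∂₂P = ⟪(U·∇)U + ∇P, e₂⟫ = 0`, and the head equals `p₀` beyond the support.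
[cite: JiuXin2008, (3.27)–(3.28)] -/
theorem axis_bernoulli (hU : ContDiff ℝ 1 U) (hP : ContDiff ℝ 1 P) (hax : IsAxisymmetric U)
    (hE : ∀ x, convect U U x + gradient P x = 0) {R p₀ : ℝ}
    (hUR : tsupport U ⊆ Metric.closedBall 0 R) (hp : ∀ x, x ∉ Metric.closedBall (0 : E3) R → P x = p₀)
    (t : ℝ) :
    P (t • EuclideanSpace.single 2 (1 : ℝ)) - p₀ = -((U (t • EuclideanSpace.single 2 (1 : ℝ)) 2) ^ 2 / 2) := by
  set e : E3 := EuclideanSpace.single 2 (1 : ℝ) with he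
  have hUd : Differentiable ℝ U := hU.differentiable one_ne_zero
  have hPd : Differentiable ℝ P := hP.differentiable one_ne_zero
  -- the head along the axis
  set f : ℝ → ℝ := fun s => (U (s • e) 2) ^ 2 / 2 + P (s • e) with hf
  have hline : ∀ s : ℝ, HasDerivAt (fun s : ℝ => s • e) e s := fun s => by
    simpa using (hasDerivAt_id s).smul_const e
  have hderiv : ∀ s, HasDerivAt f 0 s := by
    intro s
    set a : E3 := s • e with ha
    have ha0 : a 0 = 0 := by simp [ha, he]
    have ha1 : a 1 = 0 := by simp [ha, he]
    -- `d/ds U(s e) = DU(a) e`, `d/ds P(s e) = DP(a) e`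
    have hU' : HasDerivAt (fun s : ℝ => U (s • e)) (fderiv ℝ U a e) s :=
      (hUd a).hasFDerivAt.comp_hasDerivAt s (hline s)
    have hU2 : HasDerivAt (fun s : ℝ => U (s • e) 2) (fderiv ℝ U a e 2) s :=
      (EuclideanSpace.proj (2 : Fin 3) : E3 →L[ℝ] ℝ).hasFDerivAt.comp_hasDerivAt s hU'
    have hP' : HasDerivAt (fun s : ℝ => P (s • e)) (fderiv ℝ P a e) s :=
      (hPd a).hasFDerivAt.comp_hasDerivAt s (hline s)
    have hsum := ((hU2.pow 2).div_const 2).add hP'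
    -- Euler on the axis: `DP(a) e = -U₂(a) (DU(a) e)₂`
    have hUa : U a = (U a 2) • e := apply_axis_eq_smul hax hUd ha0 ha1
    have hEa : fderiv ℝ P a e = -(U a 2 * fderiv ℝ U a e 2) := by
      have h1 := hE a
      rw [convect_apply, hUa, map_smul] at h1
      have h2 : gradient P a = -((U a 2) • fderiv ℝ U a e) := eq_neg_of_add_eq_zero_right h1
      have h3 : fderiv ℝ P a e = ⟪gradient P a, e⟫ := by
        rw [gradient, InnerProductSpace.toDual_symm_apply]
      rw [h3, h2, inner_neg_left, inner_smul_left, he, EuclideanSpace.inner_single_right]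
      simp
    have : (↑(2 : ℕ) * U (s • e) 2 ^ (2 - 1) * fderiv ℝ U a e 2) / 2 + fderiv ℝ P a e = 0 := by
      rw [hEa]; ring
    rw [this] at hsum
    exact hsum
  have hconst : ∀ s₁ s₂, f s₁ = f s₂ :=
    is_const_of_deriv_eq_zero (fun s => (hderiv s).differentiableAt) fun s => (hderiv s).deriv
  -- beyond the support the head is `p₀`
  have hfar : f (R + 1 + |R|) = p₀ := by
    have he1 : ‖e‖ = 1 := by simp [he]
    have hnorm : ‖(R + 1 + |R|) • e‖ = R + 1 + |R| := by
      rw [norm_smul, he1, mul_one, Real.norm_of_nonneg]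
      linarith [abs_nonneg R, neg_abs_le R]
    have hout : (R + 1 + |R|) • e ∉ Metric.closedBall (0 : E3) R := by
      rw [Metric.mem_closedBall, dist_zero_right, hnorm, not_le]; linarith [le_abs_self R, abs_nonneg R]
    have hU0 : U ((R + 1 + |R|) • e) = 0 := image_eq_zero_of_notMem_tsupport fun h => hout (hUR h)
    simp [hf, hU0, hp _ hout]
  have := hconst t (R + 1 + |R|)
  rw [hfar, hf] at this
  simp only at this
  linarith

/-- The axis pressure is below `p₀`: `P(x − x_h) − p₀ ≤ 0`. -/
theorem pressure_axis_le (hU : ContDiff ℝ 1 U) (hP : ContDiff ℝ 1 P) (hax : IsAxisymmetric U)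
    (hE : ∀ x, convect U U x + gradient P x = 0) {R p₀ : ℝ}
    (hUR : tsupport U ⊆ Metric.closedBall 0 R) (hp : ∀ x, x ∉ Metric.closedBall (0 : E3) R → P x = p₀)
    (x : E3) : P (x - hor x) - p₀ ≤ 0 := by
  rw [sub_hor_eq_smul, axis_bernoulli hU hP hax hE hUR hp]
  have := sq_nonneg (U ((x 2) • EuclideanSpace.single 2 (1 : ℝ)) 2)
  linarith

/-- **Near-axis pressure bound**: with `‖DP‖ ≤ M_P`, `P(x) − p₀ ≤ M_P ‖x_h‖` (mean value from the axis point
`x − x_h`, where `P − p₀ ≤ 0`). -/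
theorem pressure_sub_le (hU : ContDiff ℝ 1 U) (hP : ContDiff ℝ 1 P) (hax : IsAxisymmetric U)
    (hE : ∀ x, convect U U x + gradient P x = 0) {R p₀ : ℝ}
    (hUR : tsupport U ⊆ Metric.closedBall 0 R) (hp : ∀ x, x ∉ Metric.closedBall (0 : E3) R → P x = p₀)
    {MP : ℝ} (hMP : ∀ x, ‖fderiv ℝ P x‖ ≤ MP) (x : E3) : P x - p₀ ≤ MP * ‖hor x‖ := by
  have hmv : ‖P x - P (x - hor x)‖ ≤ MP * ‖x - (x - hor x)‖ :=
    (convex_univ).norm_image_sub_le_of_norm_fderiv_le (fun y _ => hP.differentiable one_ne_zero y)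
      (fun y _ => hMP y) (mem_univ _) (mem_univ _)
  rw [sub_sub_cancel, Real.norm_eq_abs] at hmv
  have h1 := pressure_axis_le hU hP hax hE hUR hp x
  linarith [le_abs_self (P x - P (x - hor x))]

end Euler

/-! ## The radial cut-off -/

/-- `Real.smoothTransition` is locally constant off `[0,1]`, so its derivative vanishes there. -/
theorem deriv_smoothTransition_eq_zero_of_neg {y : ℝ} (hy : y < 0) : deriv Real.smoothTransition y = 0 := by
  have hev : Real.smoothTransition =ᶠ[𝓝 y] fun _ => (0 : ℝ) := by
    filter_upwards [Iio_mem_nhds hy] with z hz using Real.smoothTransition.zero_of_nonpos hz.le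
  rw [hev.deriv_eq, deriv_const]

/-- The radial cut-off `χ_R(x) = smoothTransition((4R² − ‖x‖²)/(3R²))`: `= 1` on `B̄(0,R)`, `= 0` off `B(0,2R)`. -/
def cutoff (R : ℝ) (x : E3) : ℝ := Real.smoothTransition ((4 * R ^ 2 - ‖x‖ ^ 2) * (3 * R ^ 2)⁻¹)

/-- The radial factor of `∇χ_R`: `Dχ_R(x) v = c_R(x) ⟪x, v⟫`. -/
def cutoffCoeff (R : ℝ) (x : E3) : ℝ :=
  deriv Real.smoothTransition ((4 * R ^ 2 - ‖x‖ ^ 2) * (3 * R ^ 2)⁻¹) * (-(2 * (3 * R ^ 2)⁻¹))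

/-- `χ_R ≥ 0`. -/
theorem cutoff_nonneg (R : ℝ) (x : E3) : 0 ≤ cutoff R x := Real.smoothTransition.nonneg _

/-- `χ_R ≤ 1`. -/
theorem cutoff_le_one (R : ℝ) (x : E3) : cutoff R x ≤ 1 := Real.smoothTransition.le_one _

/-- `χ_R = 1` on the closed ball `B̄(0,R)` (`R > 0`). -/
theorem cutoff_eq_one {R : ℝ} (hR : 0 < R) {x : E3} (hx : x ∈ Metric.closedBall (0 : E3) R) :
    cutoff R x = 1 := by
  rw [Metric.mem_closedBall, dist_zero_right] at hx
  refine Real.smoothTransition.one_of_one_le ?_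
  rw [← div_eq_mul_inv, le_div_iff₀ (by positivity)]
  have : ‖x‖ ^ 2 ≤ R ^ 2 := pow_le_pow_left₀ (norm_nonneg x) hx 2
  linarith

/-- `χ_R = 0` off the ball `B(0,2R)` (`R > 0`). -/
theorem cutoff_eq_zero {R : ℝ} (hR : 0 < R) {x : E3} (hx : 2 * R ≤ ‖x‖) : cutoff R x = 0 := by
  refine Real.smoothTransition.zero_of_nonpos ?_
  rw [← div_eq_mul_inv]
  apply div_nonpos_of_nonpos_of_nonneg _ (by positivity)
  have : (2 * R) ^ 2 ≤ ‖x‖ ^ 2 := pow_le_pow_left₀ (by positivity) hx 2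
  linarith

/-- `χ_R` is smooth. -/
theorem contDiff_cutoff {n : ℕ∞} (R : ℝ) : ContDiff ℝ n (cutoff R) := by
  unfold cutoff
  have hn : ContDiff ℝ n fun y : E3 => ‖y‖ ^ 2 := contDiff_norm_sq ℝ
  exact (Real.smoothTransition.contDiff (n := n)).comp ((contDiff_const.sub hn).mul contDiff_const)

/-- `χ_R` has compact support (in `B̄(0,2R)`). -/
theorem hasCompactSupport_cutoff {R : ℝ} (hR : 0 < R) : HasCompactSupport (cutoff R) :=
  HasCompactSupport.intro (isCompact_closedBall (0 : E3) (2 * R)) fun x hx => by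
    rw [Metric.mem_closedBall, dist_zero_right, not_le] at hx
    exact cutoff_eq_zero hR hx.le

/-- The derivative of `χ_R` is radial: `Dχ_R(x) = c_R(x) ⟪x, ·⟫`. -/
theorem hasFDerivAt_cutoff (R : ℝ) (x : E3) :
    HasFDerivAt (cutoff R) (cutoffCoeff R x • innerSL ℝ x) x := by
  have h1 := ((hasStrictFDerivAt_norm_sq x).hasFDerivAt.const_sub (4 * R ^ 2)).mul_const ((3 * R ^ 2)⁻¹)
  have h2 : HasDerivAt Real.smoothTransition
      (deriv Real.smoothTransition ((4 * R ^ 2 - ‖x‖ ^ 2) * (3 * R ^ 2)⁻¹))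
      ((4 * R ^ 2 - ‖x‖ ^ 2) * (3 * R ^ 2)⁻¹) :=
    ((Real.smoothTransition.contDiff (n := 1)).differentiable one_ne_zero _).hasDerivAt
  have h3 : HasFDerivAt (cutoff R) (deriv Real.smoothTransition ((4 * R ^ 2 - ‖x‖ ^ 2) * (3 * R ^ 2)⁻¹) •
      ((3 * R ^ 2)⁻¹ • -((2 : ℕ) • innerSL ℝ x))) x := h2.comp_hasFDerivAt x h1
  refine h3.congr_fderiv ?_
  ext v
  simp [cutoffCoeff, two_smul]
  ring

/-- `Dχ_R(x) v = c_R(x) ⟪x, v⟫`. -/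
theorem fderiv_cutoff_apply (R : ℝ) (x v : E3) : fderiv ℝ (cutoff R) x v = cutoffCoeff R x * ⟪x, v⟫ := by
  rw [(hasFDerivAt_cutoff R x).fderiv]; simp

/-- `c_R` is continuous. -/
theorem continuous_cutoffCoeff (R : ℝ) : Continuous (cutoffCoeff R) := by
  unfold cutoffCoeff
  refine (((Real.smoothTransition.contDiff (n := 1)).continuous_deriv le_rfl).comp ?_).mul continuous_const
  exact (continuous_const.sub (continuous_norm.pow 2)).mul continuous_const

/-- `c_R` has compact support (in `B̄(0,2R)`): `smoothTransition` is constant off `[0,1]`. -/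
theorem hasCompactSupport_cutoffCoeff {R : ℝ} (hR : 0 < R) : HasCompactSupport (cutoffCoeff R) :=
  HasCompactSupport.intro (isCompact_closedBall (0 : E3) (2 * R)) fun x hx => by
    rw [Metric.mem_closedBall, dist_zero_right, not_le] at hx
    have hx2 : (2 * R) ^ 2 < ‖x‖ ^ 2 := pow_lt_pow_left₀ hx (by positivity) two_ne_zero
    have hneg : (4 * R ^ 2 - ‖x‖ ^ 2) * (3 * R ^ 2)⁻¹ < 0 := by
      rw [← div_eq_mul_inv]; exact div_neg_of_neg_of_pos (by nlinarith) (by positivity)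
    rw [cutoffCoeff, deriv_smoothTransition_eq_zero_of_neg hneg, zero_mul]

/-- **Uniform mass bound**: `∫ χ_R · div G_ε ≤ ∫ |c_R|` for every `ε ≠ 0` — since `∫ χ div G = −∫ ⟪G, ∇χ⟫` and
`⟪G_ε, ∇χ_R⟫ = c_R ⟪x, G_ε x⟫` with `0 ≤ ⟪x, G_ε x⟫ ≤ 1`. -/
theorem integral_cutoff_mul_divergence_le {R : ℝ} (hR : 0 < R) {ε : ℝ} (hε : ε ≠ 0) :
    ∫ x, cutoff R x * VectorCalculus.divergence (testField ε) x ≤ ∫ x, |cutoffCoeff R x| := by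
  have h := integral_mul_divergence_add_eq_zero_left (contDiff_cutoff (n := 1) R)
    (contDiff_testField (n := 1) hε) (hasCompactSupport_cutoff hR)
  have heq : ∫ x, cutoff R x * VectorCalculus.divergence (testField ε) x =
      -∫ x, ⟪testField ε x, gradient (cutoff R) x⟫ := by linarith
  rw [heq, ← integral_neg]
  have hgc : HasCompactSupport (fderiv ℝ (cutoff R)) := (hasCompactSupport_cutoff hR).fderiv (𝕜 := ℝ)
  have hi1 : Integrable (fun x => -⟪testField ε x, gradient (cutoff R) x⟫) (volume : Measure E3) := by
    refine (((continuous_testField hε).inner (continuous_gradient_of_contDiff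
      (contDiff_cutoff (n := 1) R))).neg).integrable_of_hasCompactSupport (hgc.mono fun x hx => ?_)
    rw [Function.mem_support] at hx ⊢
    contrapose! hx
    simp [gradient, hx]
  have hi2 : Integrable (fun x => |cutoffCoeff R x|) (volume : Measure E3) :=
    ((continuous_cutoffCoeff R).abs).integrable_of_hasCompactSupport (hasCompactSupport_cutoffCoeff hR).abs
  refine integral_mono hi1 hi2 fun x => ?_
  have h1 : ⟪testField ε x, gradient (cutoff R) x⟫ = cutoffCoeff R x * ⟪x, testField ε x⟫ := by
    rw [real_inner_comm, gradient, InnerProductSpace.toDual_symm_apply, fderiv_cutoff_apply]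
  have h2 := abs_inner_self_testField_le_one hε x
  show -⟪testField ε x, gradient (cutoff R) x⟫ ≤ |cutoffCoeff R x|
  rw [h1]
  calc -(cutoffCoeff R x * ⟪x, testField ε x⟫) ≤ |cutoffCoeff R x * ⟪x, testField ε x⟫| := neg_le_abs _
    _ = |cutoffCoeff R x| * |⟪x, testField ε x⟫| := abs_mul _ _
    _ ≤ |cutoffCoeff R x| * 1 := by gcongr
    _ = |cutoffCoeff R x| := mul_one _


/-! ## The pressure side of the regularised Jiu–Xin identity -/

section Pressure

variable {U : E3 → E3} {P : E3 → ℝ}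

/-- AM–GM in the form used below: `‖h‖ ≤ δ/2 + ‖h‖²/(2δ)` for `δ > 0`. -/
theorem norm_le_half_add_sq_div (h : E3) {δ : ℝ} (hδ : 0 < δ) : ‖h‖ ≤ δ / 2 + ‖h‖ ^ 2 / (2 * δ) := by
  rw [← sub_nonneg]
  have : δ / 2 + ‖h‖ ^ 2 / (2 * δ) - ‖h‖ = (‖h‖ - δ) ^ 2 / (2 * δ) := by
    field_simp
    ring
  rw [this]
  positivity

/-- **The pressure side is small.** For the compactly supported `C¹` steady axisymmetric Euler pair with `P ≡ p₀` off
`B̄(0,R)`, `‖DP‖ ≤ M_P`, every `ε ≠ 0` and every `δ > 0`: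
`∫ (P − p₀)·2ε²/(ρ²+ε²)² ≤ M_P (δ/2) ∫|c_R| + (M_P/2δ) ∫ χ_R ρ² · 2ε²/(ρ²+ε²)²`
(pointwise `P − p₀ ≤ M_P ‖x_h‖ ≤ M_P(δ/2 + ρ²/2δ)` on the support by the axis Bernoulli sign, mean value and AM–GM;
then the uniform mass bound `∫ χ_R div G_ε ≤ ∫ |c_R|`). [cite: JiuXin2008, (3.24)–(3.28)] -/
theorem pressure_integral_le (hU : ContDiff ℝ 1 U) (hP : ContDiff ℝ 1 P) (hax : IsAxisymmetric U)
    (hE : ∀ x, convect U U x + gradient P x = 0) {R p₀ : ℝ} (hR : 0 < R)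
    (hUR : tsupport U ⊆ Metric.closedBall 0 R) (hp : ∀ x, x ∉ Metric.closedBall (0 : E3) R → P x = p₀)
    {MP : ℝ} (hMP : ∀ x, ‖fderiv ℝ P x‖ ≤ MP) {ε : ℝ} (hε : ε ≠ 0) {δ : ℝ} (hδ : 0 < δ) :
    ∫ x, (P x - p₀) * (2 * ε ^ 2 / (cylSq x + ε ^ 2) ^ 2) ≤
      MP * (δ / 2) * (∫ x, |cutoffCoeff R x|) +
        MP / (2 * δ) * ∫ x, cutoff R x * (cylSq x * (2 * ε ^ 2 / (cylSq x + ε ^ 2) ^ 2)) := by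
  have hMP0 : 0 ≤ MP := (norm_nonneg _).trans (hMP 0)
  -- the kernel `k_ε = div G_ε ≥ 0` and its continuity
  set k : E3 → ℝ := fun x => 2 * ε ^ 2 / (cylSq x + ε ^ 2) ^ 2 with hk
  have hk0 : ∀ x, 0 ≤ k x := fun x => by positivity
  have hkc : Continuous k :=
    continuous_const.div ((continuous_cylSq.add continuous_const).pow 2)
      fun x => pow_ne_zero 2 (cylSq_add_sq_pos hε x).ne'
  have hχc : Continuous (cutoff R) := (contDiff_cutoff (n := 0) R).continuous
  have hχs : HasCompactSupport (cutoff R) := hasCompactSupport_cutoff hR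
  -- pointwise bound
  have hpt : ∀ x, (P x - p₀) * k x ≤ MP * (δ / 2 + cylSq x / (2 * δ)) * cutoff R x * k x := by
    intro x
    by_cases hx : x ∈ Metric.closedBall (0 : E3) R
    · rw [cutoff_eq_one hR hx, mul_one]
      refine mul_le_mul_of_nonneg_right ?_ (hk0 x)
      calc P x - p₀ ≤ MP * ‖hor x‖ := pressure_sub_le hU hP hax hE hUR hp hMP x
        _ ≤ MP * (δ / 2 + ‖hor x‖ ^ 2 / (2 * δ)) :=
          mul_le_mul_of_nonneg_left (norm_le_half_add_sq_div _ hδ) hMP0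
        _ = MP * (δ / 2 + cylSq x / (2 * δ)) := by rw [norm_hor_sq]
    · rw [hp x hx, sub_self, zero_mul]
      have := cylSq_nonneg x
      have := cutoff_nonneg R x
      have := hk0 x
      positivity
  -- integrability of both sides
  have hPc : HasCompactSupport fun x => P x - p₀ := hasCompactSupport_sub_const hp
  have hiL : Integrable (fun x => (P x - p₀) * k x) (volume : Measure E3) :=
    ((hP.continuous.sub continuous_const).mul hkc).integrable_of_hasCompactSupport hPc.mul_right
  have hi1 : Integrable (fun x => cutoff R x * k x) (volume : Measure E3) :=
    (hχc.mul hkc).integrable_of_hasCompactSupport hχs.mul_right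
  have hi2 : Integrable (fun x => cutoff R x * (cylSq x * k x)) (volume : Measure E3) :=
    (hχc.mul (continuous_cylSq.mul hkc)).integrable_of_hasCompactSupport hχs.mul_right
  have hiR : Integrable (fun x => MP * (δ / 2 + cylSq x / (2 * δ)) * cutoff R x * k x)
      (volume : Measure E3) := by
    have : (fun x => MP * (δ / 2 + cylSq x / (2 * δ)) * cutoff R x * k x) =
        fun x => MP * (δ / 2) * (cutoff R x * k x) + MP / (2 * δ) * (cutoff R x * (cylSq x * k x)) := by
      funext x; ring
    rw [this]
    exact (hi1.const_mul _).add (hi2.const_mul _)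
  -- integrate
  have hmono := integral_mono hiL hiR hpt
  have hsplit : ∫ x, MP * (δ / 2 + cylSq x / (2 * δ)) * cutoff R x * k x =
      MP * (δ / 2) * (∫ x, cutoff R x * k x) + MP / (2 * δ) * ∫ x, cutoff R x * (cylSq x * k x) := by
    have : (fun x => MP * (δ / 2 + cylSq x / (2 * δ)) * cutoff R x * k x) =
        fun x => MP * (δ / 2) * (cutoff R x * k x) + MP / (2 * δ) * (cutoff R x * (cylSq x * k x)) := by
      funext x; ring
    rw [this, integral_add (hi1.const_mul _) (hi2.const_mul _), integral_const_mul, integral_const_mul]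
  have hmass : ∫ x, cutoff R x * k x ≤ ∫ x, |cutoffCoeff R x| := by
    have : ∫ x, cutoff R x * k x = ∫ x, cutoff R x * VectorCalculus.divergence (testField ε) x :=
      integral_congr_ae (Eventually.of_forall fun x => by simp only [hk, divergence_testField hε])
    rw [this]
    exact integral_cutoff_mul_divergence_le hR hε
  calc ∫ x, (P x - p₀) * k x ≤ _ := hmono
    _ = _ := hsplit
    _ ≤ MP * (δ / 2) * (∫ x, |cutoffCoeff R x|) + MP / (2 * δ) * ∫ x, cutoff R x * (cylSq x * k x) :=
      add_le_add (mul_le_mul_of_nonneg_left hmass (by positivity : (0 : ℝ) ≤ MP * (δ / 2))) le_rfl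

end Pressure

end JiuXin

end Summit.NavierStokesRegularity.NavierStokesRegularity.Theorems.PoloidalLiouville.SilentShells

end
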